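import Summits.CriticalPhenomena.PercolationContinuityZ3.Theorems.PercNearOneGluingNoHeavyLowerTailStarSetFamilyLoad
import Summits.CriticalPhenomena.PercolationContinuityZ3.Theorems.PercNearOneGluingNoHeavyLowerTailStarSetLoadTriangle
import HarnessLib

/-!
# `NoHeavyLowerTail` (stmt-CriticalPhenomena-4575) — the A0 family of the unit bound: units of configurations containing an r-free triangle (blueprint §C/§G)

Support file (prover `prim-gen-swap` gen 13; `--supports stmt-CriticalPhenomena-4575`).  No definitions, no named facts, no sorries.

Rule A0 of U1-PROOF.md §3 in the form consumed by the unit bound (LEAN-BLUEPRINT-U1.md §C, §G): resources are class-SETS `T` with capacity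
`C_T := Σ_{δ valid for T} Π_{X∈T} O X (δ X)` (all valid designations: `δ = false` off `T`, three distinct designated ports, none equal to `r`).
For an r-free TRIANGLE `T` (three classes with port pairs `ab, ac, bc`, `a, b, c ≠ r`) the two rotations are valid designations, so
`C_T ≥ 128·Π_T θ` (`triangle_word_cap_ge`); every unit `(S, X)` (hub `X` adjacent to every class of `S`) whose configuration contains an r-free triangle
is charged to one such triangle `Δ(S) ⊆ S`; per triangle the hubs are sides (`portPair_of_adjacent_triangle`), so `family_load_le` with `(m, c) = (3, 128)`
gives the family bound with coefficient `3/128` against `Σ_{T r-free triangle} C_T`.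

* `StarSet.ports_iff_of_pair`, `StarSet.pick_port_eq` — port bookkeeping;
* `StarSet.triangle_rotations_le_cap` — `128·θ_Xθ_Yθ_Z ≤ C_{{X,Y,Z}}` for an r-free triangle;
* `StarSet.triangle_hub_mem` — a class adjacent to the three classes of a triangle is one of them;
* `StarSet.familyA0_bound` — `Σ_{u ∈ U} W(S_u) ≤ (3/128)·Σ_{T ∈ TRIS} C_T` for any set `U` of units on triangle configurations.
-/

namespace Summit.CriticalPhenomena.PercolationContinuityZ3.Theorems

open Finset
open scoped BigOperators Classical

namespace StarSet

variable {ι V : Type*} [Fintype ι] [DecidableEq ι] [Fintype V] [DecidableEq V]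

omit [Fintype ι] [DecidableEq ι] [Fintype V] [DecidableEq V] in
/-- The ports of a class with port pair `s(u, v)` are exactly `u` and `v`. -/
theorem ports_iff_of_pair (P P' : ι → V) {K : ι} {u v : V} (h : (s(P K, P' K) : Sym2 V) = s(u, v)) (q : V) :
    (P K = q ∨ P' K = q) ↔ (q = u ∨ q = v) := by
  have : q ∈ (s(P K, P' K) : Sym2 V) ↔ q ∈ (s(u, v) : Sym2 V) := by rw [h]
  rw [Sym2.mem_iff, Sym2.mem_iff] at this
  constructor
  · intro hq; exact this.1 (hq.imp Eq.symm Eq.symm)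
  · intro hq; exact (this.2 hq).imp Eq.symm Eq.symm

omit [Fintype ι] [DecidableEq ι] [Fintype V] in
/-- Designating the port `u ∈ K` by the Boolean `[P K = u]` designates `u`. -/
theorem pick_port_eq (P P' : ι → V) {K : ι} {u : V} (hu : P K = u ∨ P' K = u) :
    (if decide (P K = u) then P K else P' K) = u := by
  by_cases h : P K = u
  · simp [h]
  · simp [h, hu.resolve_left h]

omit [Fintype ι] [DecidableEq ι] [Fintype V] [DecidableEq V] in
/-- Two complementary factors: if the ports of `K` are `{u, v}` then `Φ_K² ≤ O_K(u)·O_K(v)` from `Φ_K² ≤ O_K(P K)·O_K(P' K)`. -/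
theorem odds_pair_of_ports (P P' : ι → V) (O : ι → V → ℝ) (Φ : ι → ℝ) {K : ι} {u v : V}
    (h : (s(P K, P' K) : Sym2 V) = s(u, v)) (hO2 : Φ K ^ 2 ≤ O K (P K) * O K (P' K)) :
    Φ K ^ 2 ≤ O K u * O K v := by
  rcases Sym2.eq_iff.1 h with ⟨h1, h2⟩ | ⟨h1, h2⟩
  · rw [← h1, ← h2]; exact hO2
  · rw [← h1, ← h2, mul_comm]; exact hO2

omit [Fintype V] in
/-- **Rotations of an r-free triangle are valid words: `128·θ_Xθ_Yθ_Z ≤ C_T`**, `T = {X, Y, Z}` with port pairs `ab, ac, bc`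
(`a, b, c` distinct and `≠ r`), where `C_T` sums `Π_T O` over all valid designations of `T`. -/
theorem triangle_rotations_le_cap (P P' : ι → V) (r : V)
    (θ : ι → ℝ) (hθ0 : ∀ X, 0 ≤ θ X) (O : ι → V → ℝ) (hO0 : ∀ X d, 0 ≤ O X d) (Φ : ι → ℝ)
    (hO2 : ∀ X, Φ X ^ 2 ≤ O X (P X) * O X (P' X)) (hΦ4 : ∀ X, 4 * θ X ≤ Φ X)
    {a b c : V} (hab : a ≠ b) (hac : a ≠ c) (hbc : b ≠ c) (har : a ≠ r) (hbr : b ≠ r) (hcr : c ≠ r)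
    {X Y Z : ι} (hX : (s(P X, P' X) : Sym2 V) = s(a, b)) (hY : (s(P Y, P' Y) : Sym2 V) = s(a, c))
    (hZ : (s(P Z, P' Z) : Sym2 V) = s(b, c)) :
    128 * (θ X * θ Y * θ Z) ≤
      ∑ δ ∈ (univ : Finset (ι → Bool)).filter (fun δ => (∀ K ∉ ({X, Y, Z} : Finset ι), δ K = false) ∧
          3 ≤ (({X, Y, Z} : Finset ι).image fun K => if δ K then P K else P' K).card ∧
          r ∉ ({X, Y, Z} : Finset ι).image fun K => if δ K then P K else P' K),
        ∏ K ∈ ({X, Y, Z} : Finset ι), O K (if δ K then P K else P' K) := by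
  -- distinct classes
  have hXY : X ≠ Y := by
    intro h
    have h' : (s(a, b) : Sym2 V) = s(a, c) := by rw [← hX, ← hY, h]
    rcases Sym2.eq_iff.1 h' with ⟨_, h2⟩ | ⟨h1, _⟩
    · exact hbc h2
    · exact hac h1
  have hXZ : X ≠ Z := by
    intro h
    have h' : (s(a, b) : Sym2 V) = s(b, c) := by rw [← hX, ← hZ, h]
    rcases Sym2.eq_iff.1 h' with ⟨h1, _⟩ | ⟨h1, _⟩
    · exact hab h1
    · exact hac h1
  have hYZ : Y ≠ Z := by
    intro h
    have h' : (s(a, c) : Sym2 V) = s(b, c) := by rw [← hY, ← hZ, h]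
    rcases Sym2.eq_iff.1 h' with ⟨h1, _⟩ | ⟨h1, _⟩
    · exact hab h1
    · exact hac h1
  have hXnot : X ∉ ({Y, Z} : Finset ι) := by simp [hXY, hXZ]
  -- ports
  have hXa : P X = a ∨ P' X = a := (ports_iff_of_pair P P' hX a).2 (Or.inl rfl)
  have hXb : P X = b ∨ P' X = b := (ports_iff_of_pair P P' hX b).2 (Or.inr rfl)
  have hYa : P Y = a ∨ P' Y = a := (ports_iff_of_pair P P' hY a).2 (Or.inl rfl)
  have hYc : P Y = c ∨ P' Y = c := (ports_iff_of_pair P P' hY c).2 (Or.inr rfl)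
  have hZb : P Z = b ∨ P' Z = b := (ports_iff_of_pair P P' hZ b).2 (Or.inl rfl)
  have hZc : P Z = c ∨ P' Z = c := (ports_iff_of_pair P P' hZ c).2 (Or.inr rfl)
  -- the two rotations
  set ρ₁ : ι → Bool := fun K => if K = X then decide (P X = a) else if K = Y then decide (P Y = c)
    else if K = Z then decide (P Z = b) else false with hρ₁
  set ρ₂ : ι → Bool := fun K => if K = X then decide (P X = b) else if K = Y then decide (P Y = a)
    else if K = Z then decide (P Z = c) else false with hρ₂
  have hρ₁X : (if ρ₁ X then P X else P' X) = a := by simp only [hρ₁, if_pos rfl]; exact pick_port_eq P P' hXa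
  have hρ₁Y : (if ρ₁ Y then P Y else P' Y) = c := by
    simp only [hρ₁, if_neg hXY.symm]; exact pick_port_eq P P' hYc
  have hρ₁Z : (if ρ₁ Z then P Z else P' Z) = b := by
    simp only [hρ₁, if_neg hXZ.symm, if_neg hYZ.symm]; exact pick_port_eq P P' hZb
  have hρ₂X : (if ρ₂ X then P X else P' X) = b := by simp only [hρ₂, if_pos rfl]; exact pick_port_eq P P' hXb
  have hρ₂Y : (if ρ₂ Y then P Y else P' Y) = a := by
    simp only [hρ₂, if_neg hXY.symm]; exact pick_port_eq P P' hYa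
  have hρ₂Z : (if ρ₂ Z then P Z else P' Z) = c := by
    simp only [hρ₂, if_neg hXZ.symm, if_neg hYZ.symm]; exact pick_port_eq P P' hZc
  -- images
  have himg : ∀ (δ : ι → Bool) (x y z : V), (if δ X then P X else P' X) = x → (if δ Y then P Y else P' Y) = y →
      (if δ Z then P Z else P' Z) = z →
      (({X, Y, Z} : Finset ι).image fun K => if δ K then P K else P' K) = {x, y, z} := by
    intro δ x y z h1 h2 h3
    rw [image_insert, image_insert, image_singleton, h1, h2, h3]
  have hvalid : ∀ (δ : ι → Bool) (x y z : V), x ≠ y → x ≠ z → y ≠ z → x ≠ r → y ≠ r → z ≠ r →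
      (∀ K ∉ ({X, Y, Z} : Finset ι), δ K = false) →
      (if δ X then P X else P' X) = x → (if δ Y then P Y else P' Y) = y → (if δ Z then P Z else P' Z) = z →
      δ ∈ (univ : Finset (ι → Bool)).filter (fun δ => (∀ K ∉ ({X, Y, Z} : Finset ι), δ K = false) ∧
          3 ≤ (({X, Y, Z} : Finset ι).image fun K => if δ K then P K else P' K).card ∧
          r ∉ ({X, Y, Z} : Finset ι).image fun K => if δ K then P K else P' K) := by
    intro δ x y z hxy hxz hyz hxr hyr hzr hoff h1 h2 h3
    rw [mem_filter, himg δ x y z h1 h2 h3]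
    refine ⟨mem_univ _, hoff, ?_, ?_⟩
    · rw [card_insert_of_notMem (by simp [hxy, hxz]), card_pair hyz]
    · simp [Ne.symm hxr, Ne.symm hyr, Ne.symm hzr]
  have hoff₁ : ∀ K ∉ ({X, Y, Z} : Finset ι), ρ₁ K = false := by
    intro K hK
    simp only [mem_insert, mem_singleton, not_or] at hK
    simp only [hρ₁, if_neg hK.1, if_neg hK.2.1, if_neg hK.2.2]
  have hoff₂ : ∀ K ∉ ({X, Y, Z} : Finset ι), ρ₂ K = false := by
    intro K hK
    simp only [mem_insert, mem_singleton, not_or] at hK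
    simp only [hρ₂, if_neg hK.1, if_neg hK.2.1, if_neg hK.2.2]
  have hmem₁ := hvalid ρ₁ a c b hac hab (Ne.symm hbc) har hcr hbr hoff₁ hρ₁X hρ₁Y hρ₁Z
  have hmem₂ := hvalid ρ₂ b a c (Ne.symm hab) hbc hac hbr har hcr hoff₂ hρ₂X hρ₂Y hρ₂Z
  have hne : ρ₁ ≠ ρ₂ := by
    intro h
    have : (if ρ₁ X then P X else P' X) = (if ρ₂ X then P X else P' X) := by rw [h]
    rw [hρ₁X, hρ₂X] at this
    exact hab this
  -- the sum over all valid designations dominates the two rotations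
  have hsub : ({ρ₁, ρ₂} : Finset (ι → Bool)) ⊆ (univ : Finset (ι → Bool)).filter (fun δ =>
      (∀ K ∉ ({X, Y, Z} : Finset ι), δ K = false) ∧
        3 ≤ (({X, Y, Z} : Finset ι).image fun K => if δ K then P K else P' K).card ∧
        r ∉ ({X, Y, Z} : Finset ι).image fun K => if δ K then P K else P' K) := by
    intro δ hδ
    rcases mem_insert.1 hδ with rfl | hδ
    · exact hmem₁
    · rw [mem_singleton.1 hδ]; exact hmem₂
  refine le_trans ?_ (sum_le_sum_of_subset_of_nonneg hsub fun δ _ _ => prod_nonneg fun K _ => hO0 _ _)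
  rw [sum_pair hne, prod_insert hXnot, prod_pair hYZ, prod_insert hXnot, prod_pair hYZ,
    hρ₁X, hρ₁Y, hρ₁Z, hρ₂X, hρ₂Y, hρ₂Z]
  have hΦ0 : ∀ K, 0 ≤ Φ K := fun K => by linarith [hΦ4 K, hθ0 K]
  have h := triangle_word_cap_ge (θ X) (θ Y) (θ Z) (Φ X) (Φ Y) (Φ Z) (O X a) (O X b) (O Y c) (O Y a) (O Z b) (O Z c)
    (hθ0 X) (hθ0 Y) (hθ0 Z) (hΦ4 X) (hΦ4 Y) (hΦ4 Z) (hO0 _ _) (hO0 _ _) (hO0 _ _) (hO0 _ _) (hO0 _ _) (hO0 _ _)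
    (odds_pair_of_ports P P' O Φ hX (hO2 X)) ?_ (odds_pair_of_ports P P' O Φ hZ (hO2 Z))
  · linarith
  · rw [mul_comm]; exact odds_pair_of_ports P P' O Φ hY (hO2 Y)

omit [Fintype ι] [Fintype V] [DecidableEq V] in
/-- **A class adjacent to the three classes of an r-free triangle is one of them** (port pairs pairwise distinct). -/
theorem triangle_hub_mem (P P' : ι → V) (hPP' : ∀ X, P X ≠ P' X)
    (hinj : Function.Injective fun X => (s(P X, P' X) : Sym2 V))
    {a b c : V} (hab : a ≠ b) (hac : a ≠ c) (hbc : b ≠ c)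
    {X Y Z : ι} (hX : (s(P X, P' X) : Sym2 V) = s(a, b)) (hY : (s(P Y, P' Y) : Sym2 V) = s(a, c))
    (hZ : (s(P Z, P' Z) : Sym2 V) = s(b, c)) (H : ι)
    (hHX : P H = P X ∨ P H = P' X ∨ P' H = P X ∨ P' H = P' X)
    (hHY : P H = P Y ∨ P H = P' Y ∨ P' H = P Y ∨ P' H = P' Y)
    (hHZ : P H = P Z ∨ P H = P' Z ∨ P' H = P Z ∨ P' H = P' Z) : H ∈ ({X, Y, Z} : Finset ι) := by
  -- adjacency to a class with ports `{u, v}` means touching `u` or `v`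
  have hconv : ∀ (K : ι) (u v : V), (s(P K, P' K) : Sym2 V) = s(u, v) →
      (P H = P K ∨ P H = P' K ∨ P' H = P K ∨ P' H = P' K) → (P H = u ∨ P H = v ∨ P' H = u ∨ P' H = v) := by
    intro K u v hK hadj
    have hp : ∀ q, (P K = q ∨ P' K = q) → q = u ∨ q = v := fun q hq => (ports_iff_of_pair P P' hK q).1 hq
    rcases hadj with h | h | h | h
    · rcases hp (P H) (Or.inl h.symm) with h' | h'
      · exact Or.inl h'
      · exact Or.inr (Or.inl h')
    · rcases hp (P H) (Or.inr h.symm) with h' | h'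
      · exact Or.inl h'
      · exact Or.inr (Or.inl h')
    · rcases hp (P' H) (Or.inl h.symm) with h' | h'
      · exact Or.inr (Or.inr (Or.inl h'))
      · exact Or.inr (Or.inr (Or.inr h'))
    · rcases hp (P' H) (Or.inr h.symm) with h' | h'
      · exact Or.inr (Or.inr (Or.inl h'))
      · exact Or.inr (Or.inr (Or.inr h'))
  rcases portPair_of_adjacent_triangle P P' hPP' hab hac hbc H (hconv X a b hX hHX) (hconv Y a c hY hHY)
    (hconv Z b c hZ hHZ) with h | h | h
  · have : H = X := hinj (h.trans hX.symm); simp [this]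
  · have : H = Y := hinj (h.trans hY.symm); simp [this]
  · have : H = Z := hinj (h.trans hZ.symm); simp [this]

/-- **The A0 family bound (U1-PROOF §3; blueprint §C (A0), §G).**  For any finite set `U` of units `(S, X)` — `X ∈ S` adjacent to every class
of `S` — whose configurations contain an r-free triangle, `Σ_{u∈U} W(S_u) ≤ (3/128)·Σ_{T r-free triangle} C_T`. -/
theorem familyA0_bound (P P' : ι → V) (hPP' : ∀ X, P X ≠ P' X)
    (hinj : Function.Injective fun X => (s(P X, P' X) : Sym2 V)) (r : V)
    (θ : ι → ℝ) (hθ0 : ∀ X, 0 ≤ θ X) (hθ1 : ∀ X, θ X ≤ 1) (O : ι → V → ℝ) (hO0 : ∀ X d, 0 ≤ O X d) (Φ : ι → ℝ)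
    (hO2 : ∀ X, Φ X ^ 2 ≤ O X (P X) * O X (P' X)) (hΦ4 : ∀ X, 4 * θ X ≤ Φ X)
    (U : Finset (Finset ι × ι))
    (hU : ∀ u ∈ U, u.2 ∈ u.1 ∧ (∀ Y ∈ u.1, P u.2 = P Y ∨ P u.2 = P' Y ∨ P' u.2 = P Y ∨ P' u.2 = P' Y) ∧
      ∃ a b c : V, a ≠ b ∧ a ≠ c ∧ b ≠ c ∧ a ≠ r ∧ b ≠ r ∧ c ≠ r ∧
        (∃ X ∈ u.1, (s(P X, P' X) : Sym2 V) = s(a, b)) ∧ (∃ Y ∈ u.1, (s(P Y, P' Y) : Sym2 V) = s(a, c)) ∧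
          ∃ Z ∈ u.1, (s(P Z, P' Z) : Sym2 V) = s(b, c)) :
    ∑ u ∈ U, ((∏ k ∈ u.1, θ k) * ∏ k ∈ univ \ u.1, (1 - θ k)) ≤
      (3 / 128) * ∑ T ∈ (univ : Finset ι).powerset.filter (fun T => ∃ a b c : V, ∃ X Y Z : ι,
          a ≠ b ∧ a ≠ c ∧ b ≠ c ∧ a ≠ r ∧ b ≠ r ∧ c ≠ r ∧ T = {X, Y, Z} ∧
          (s(P X, P' X) : Sym2 V) = s(a, b) ∧ (s(P Y, P' Y) : Sym2 V) = s(a, c) ∧ (s(P Z, P' Z) : Sym2 V) = s(b, c)),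
        ∑ δ ∈ (univ : Finset (ι → Bool)).filter (fun δ => (∀ K ∉ T, δ K = false) ∧
            3 ≤ (T.image fun K => if δ K then P K else P' K).card ∧ r ∉ T.image fun K => if δ K then P K else P' K),
          ∏ K ∈ T, O K (if δ K then P K else P' K) := by
  -- capacity of a class-set
  set C : Finset ι → ℝ := fun T => ∑ δ ∈ (univ : Finset (ι → Bool)).filter (fun δ => (∀ K ∉ T, δ K = false) ∧
      3 ≤ (T.image fun K => if δ K then P K else P' K).card ∧ r ∉ T.image fun K => if δ K then P K else P' K),
    ∏ K ∈ T, O K (if δ K then P K else P' K) with hC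
  have hC0 : ∀ T, 0 ≤ C T := fun T => sum_nonneg fun δ _ => prod_nonneg fun K _ => hO0 _ _
  -- for each unit choose a triangle with all the needed properties
  have hex : ∀ u ∈ U, ∃ T : Finset ι, T ⊆ u.1 ∧
      (∃ a b c : V, ∃ X Y Z : ι, a ≠ b ∧ a ≠ c ∧ b ≠ c ∧ a ≠ r ∧ b ≠ r ∧ c ≠ r ∧ T = {X, Y, Z} ∧
        (s(P X, P' X) : Sym2 V) = s(a, b) ∧ (s(P Y, P' Y) : Sym2 V) = s(a, c) ∧ (s(P Z, P' Z) : Sym2 V) = s(b, c)) ∧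
      128 * ∏ K ∈ T, θ K ≤ C T ∧ T.card = 3 ∧
      (∀ H : ι, (∀ K ∈ T, P H = P K ∨ P H = P' K ∨ P' H = P K ∨ P' H = P' K) → H ∈ T) := by
    intro u hu
    obtain ⟨-, -, a, b, c, hab, hac, hbc, har, hbr, hcr, ⟨X, hXS, hX⟩, ⟨Y, hYS, hY⟩, ⟨Z, hZS, hZ⟩⟩ := hU u hu
    have hXY : X ≠ Y := by
      intro h
      have h' : (s(a, b) : Sym2 V) = s(a, c) := by rw [← hX, ← hY, h]
      rcases Sym2.eq_iff.1 h' with ⟨_, h2⟩ | ⟨h1, _⟩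
      · exact hbc h2
      · exact hac h1
    have hXZ : X ≠ Z := by
      intro h
      have h' : (s(a, b) : Sym2 V) = s(b, c) := by rw [← hX, ← hZ, h]
      rcases Sym2.eq_iff.1 h' with ⟨h1, _⟩ | ⟨h1, _⟩
      · exact hab h1
      · exact hac h1
    have hYZ : Y ≠ Z := by
      intro h
      have h' : (s(a, c) : Sym2 V) = s(b, c) := by rw [← hY, ← hZ, h]
      rcases Sym2.eq_iff.1 h' with ⟨h1, _⟩ | ⟨h1, _⟩
      · exact hab h1
      · exact hac h1
    have hXnot : X ∉ ({Y, Z} : Finset ι) := by simp [hXY, hXZ]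
    refine ⟨{X, Y, Z}, ?_, ⟨a, b, c, X, Y, Z, hab, hac, hbc, har, hbr, hcr, rfl, hX, hY, hZ⟩, ?_, ?_, ?_⟩
    · intro K hK
      rcases mem_insert.1 hK with rfl | hK
      · exact hXS
      rcases mem_insert.1 hK with rfl | hK
      · exact hYS
      · rw [mem_singleton.1 hK]; exact hZS
    · have h := triangle_rotations_le_cap P P' r θ hθ0 O hO0 Φ hO2 hΦ4 hab hac hbc har hbr hcr hX hY hZ
      simp only [hC]
      rw [prod_insert hXnot, prod_pair hYZ]
      linarith [h]
    · rw [card_insert_of_notMem hXnot, card_pair hYZ]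
    · intro H hH
      exact triangle_hub_mem P P' hPP' hinj hab hac hbc hX hY hZ H
        (hH X (by simp)) (hH Y (by simp)) (hH Z (by simp))
  -- the resource map
  set res : Finset ι × ι → Finset ι := fun u => if h : u ∈ U then (hex u h).choose else ∅ with hres
  have hres_spec : ∀ u (hu : u ∈ U), res u ⊆ u.1 ∧
      (∃ a b c : V, ∃ X Y Z : ι, a ≠ b ∧ a ≠ c ∧ b ≠ c ∧ a ≠ r ∧ b ≠ r ∧ c ≠ r ∧ res u = {X, Y, Z} ∧
        (s(P X, P' X) : Sym2 V) = s(a, b) ∧ (s(P Y, P' Y) : Sym2 V) = s(a, c) ∧ (s(P Z, P' Z) : Sym2 V) = s(b, c)) ∧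
      128 * ∏ K ∈ res u, θ K ≤ C (res u) ∧ (res u).card = 3 ∧
      (∀ H : ι, (∀ K ∈ res u, P H = P K ∨ P H = P' K ∨ P' H = P K ∨ P' H = P' K) → H ∈ res u) := by
    intro u hu
    simp only [hres, dif_pos hu]
    exact (hex u hu).choose_spec
  -- the generic family bound with (m, c) = (3, 128)
  have hmain := family_load_le θ hθ0 hθ1 U res (fun u => u.2) res C (fun u hu => hC0 _) 3 128 (by norm_num)
    (fun u hu => (hres_spec u hu).1) (fun u _ v _ h _ => h) (fun u _ v _ _ hk h1 => Prod.ext h1 hk)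
    (fun u hu => by
      have h := (hres_spec u hu).2.2.1
      rw [le_div_iff₀ (by norm_num : (0:ℝ) < 128)]; linarith)
    (fun T hT => by
      obtain ⟨u₀, hu₀, hu₀T⟩ := mem_image.1 hT
      have hsub : (U.filter (fun u => res u = T)).image (fun u => u.2) ⊆ T := by
        intro H hH
        obtain ⟨u, hu, rfl⟩ := mem_image.1 hH
        have huU : u ∈ U := (mem_filter.1 hu).1
        have huT : res u = T := (mem_filter.1 hu).2
        rw [← huT]
        refine (hres_spec u huU).2.2.2.2 u.2 fun K hK => ?_
        exact (hU u huU).2.1 K ((hres_spec u huU).1 hK)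
      calc ((U.filter (fun u => res u = T)).image (fun u => u.2)).card ≤ T.card := card_le_card hsub
        _ = 3 := by rw [← hu₀T]; exact (hres_spec u₀ hu₀).2.2.2.1)
  refine hmain.trans ?_
  rw [show ((3 : ℕ) : ℝ) / 128 = 3 / 128 by norm_num]
  refine mul_le_mul_of_nonneg_left (sum_le_sum_of_subset_of_nonneg (fun T hT => ?_) fun T _ _ => hC0 T) (by norm_num)
  obtain ⟨u, hu, rfl⟩ := mem_image.1 hT
  exact mem_filter.2 ⟨mem_powerset.2 (subset_univ _), (hres_spec u hu).2.1⟩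

end StarSet

end Summit.CriticalPhenomena.PercolationContinuityZ3.Theorems
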